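import Literature.Barriers.CriticalPhenomena.SupercriticalSAWSpaceFillingProofsNarrow
import Literature.Barriers.CriticalPhenomena.SupercriticalSAWSpaceFillingRefutation
import Literature.Probability.RandomPlanarGeometry.CritPercSLESimplePathHolds
import Literature.Probability.RandomPlanarGeometry.SimpleCurves
import Literature.Probability.RandomPlanarGeometry.ConformalRestrictionProofs
import HarnessLib

/-!
# The `blocks:` line of `SupercriticalSAWSpaceFilling`, unconditionally: a simple curve covers
# no open set, so Theorem 1 of Duminil-Copin–Kozma–Yadin and the Rohde–Schramm simplicity
# theorem (both proved in the tree) refute `RobustSAWScalingLimit` with no further input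

Barrier catalogue `Literature/Barriers/CriticalPhenomena/` (D-0021); dependency audit of the
mechanism of `SupercriticalSAWSpaceFilling` (third barrier audit, 2026-08-15, refuter, gen 3;
companion of `…ProofsClosed`). The catalogued `blocks:` line of the barrier — Theorem 1 of
H. Duminil-Copin, G. Kozma, A. Yadin, *Supercritical self-avoiding walks are space-filling*,
Ann. IHP Probab. Stat. 50 (2014) 315–326 (arXiv:1110.3074) refutes the fugacity-robust
strengthening `SupercriticalSAW.RobustSAWScalingLimit` of the sub-problem — was machine-checked
"conditionally on the two SLE facts" `sle_restriction_eightThirds` [LSW03, Thm 6.1] and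
`ae_isSimpleTrace_sleTrace_of_le_four` [RS05, Thm 6.1]
(`SupercriticalSAWSpaceFilling.not_robustSAWScalingLimit`, `…Refutation`). This file removes
both hypotheses:

* the restriction formula [LSW03] is not needed at all — the mechanism in its sharp form
  (`SupercriticalSAW.IsSpaceFillingLaws.not_convergesInLawToSLE_of_not_ae_onto`, `…ProofsNarrow`)
  only needs that the candidate limit is not almost surely ONTO the domain, and a SIMPLE curve is
  onto no open set: `not_subset_range_of_injective_curve` — if a continuous injective
  `γ : [0,1] → ℂ` covered an open set, a circle `C` would lie in its trace, `γ` is a homeomorphism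
  onto its trace (compact to Hausdorff, Mathlib `Continuous.isClosedEmbedding`), and `γ⁻¹ ∘ C`
  would be a continuous injection of a circle into `[0,1]`, impossible by the one-dimensional
  Borsuk–Ulam argument `exists_eq_add_pi_of_continuous` (`θ ↦ f(θ) - f(θ+π)` changes sign on
  `[0, π]`, intermediate value theorem);
* the simplicity of the SLE_κ trace for `0 < κ ≤ 4` [RS05, Thm 6.1] is PROVED in the tree
  (`ae_isSimpleTrace_sleTrace_of_le_four_holds`, `CritPercSLESimplePathHolds.lean`) and
  transported to Dobrushin domains by `IsSLELaw.ae_simple` (`ConformalRestrictionProofs.lean`,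
  with `CurveClass.measurableSet_simple_holds`), whence
  `not_ae_carrier_subset_range_of_isSLECurve`: chordal SLE_κ in `(D; a, b)`, `0 < κ ≤ 4`, is
  not almost surely onto `D`.

Consequences, all hypothesis-free theorems of the tree (axioms `propext`, `Classical.choice`,
`Quot.sound`): `IsSpaceFillingLaws.not_convergesInLawToSLE_of_le_four` (weakly space-filling
SAW laws converge to no chordal SLE_κ, `0 < κ ≤ 4`), `not_convergesInLawToSLE_supercritical_unitDisc`
(the SAW with any parameter `x > x_c` in `(𝔻; 1, -1)` with closest-site endpoints converges to
no chordal SLE_κ, `0 < κ ≤ 4` [DKY14, Thm 1 = `DKY2014_thm1_holds`]), `not_sawScalingLimitAt_of_lt`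
(`¬ SAWScalingLimitAt x` for every `x > x_c`), **`not_robustSAWScalingLimit`
(`¬ RobustSAWScalingLimit`, unconditionally)**, and `DKY2014_problem10_unitDisc_of_sawScalingLimit'`
(the `(𝔻; 1, -1)` instance of the open Problem 10 of the source follows from the
Lawler–Schramm–Werner conjecture `SAWScalingLimit` ALONE). For the catalogue this means: the
`status:` / `blocks:` lines of `SupercriticalSAWSpaceFilling` may drop "conditionally on the two
SLE facts"; the technique class `RobustSAWScalingLimit` is refuted outright, like a Theses
statement closed `refuted` (classification: refuted-substantive — the load-bearing claim, an
SLE_{8/3} limit at some `x > x_c`, contradicts two theorems; no repair short of the narrowings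
of `…Narrow` / `…ProofsNarrow`).

Mathlib: `Continuous.isClosedEmbedding`, `Topology.IsEmbedding.toHomeomorph`,
`intermediate_value_Icc`, `intermediate_value_Icc'`, `circleMap`, `periodic_circleMap`,
`circleMap_mem_sphere`, `Complex.exp_pi_mul_I`, `MeasureTheory.ae_of_ae_map`,
`Filter.Eventually.exists`.

## References

* H. Duminil-Copin, G. Kozma, A. Yadin, Ann. IHP Probab. Stat. 50 (2014) 315–326,
  arXiv:1110.3074: Theorem 1 (p. 2), Problem 10 (p. 8). [DuminilCopinKozmaYadin2014]
* S. Rohde, O. Schramm, *Basic properties of SLE*, Ann. of Math. 161 (2005) 883–924,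
  arXiv:math/0106036: §6, Thm 6.1 (arXiv p. 13: "In the range `κ ∈ [0,4]`, the SLE_κ trace is
  a.s. a simple path and `γ[0,∞) ⊆ ℍ ∪ {0}`"). [RohdeSchramm2005]
* G. F. Lawler, O. Schramm, W. Werner, *Conformal restriction: the chordal case*, J. AMS 16
  (2003), Thm 6.1 — no longer an input. [LawlerSchrammWerner2003Restriction]
-/

noncomputable section

open MeasureTheory Filter Topology Metric Set Literature.Probability.LatticeModels
  Literature.Probability.Percolation Literature.Probability.RandomPlanarGeometry
  Literature.Probability.RandomPlanarGeometry.SAW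
open scoped ENNReal NNReal Real

namespace Literature.Barriers.CriticalPhenomena

namespace SupercriticalSAW

/-! ### No continuous injection of a circle into `[0, 1]`: a simple curve covers no open set -/

section Arc

/-- **One-dimensional Borsuk–Ulam.** A continuous real function taking the same value at `0`
and `2π` takes the same value at two antipodal parameters `θ₀`, `θ₀ + π` (`θ₀ ∈ [0, π]`):
`F(θ) = f(θ) - f(θ + π)` changes sign between `0` and `π`. [folklore] -/
theorem exists_eq_add_pi_of_continuous {f : ℝ → ℝ} (hf : Continuous f) (h2π : f (2 * π) = f 0) :
    ∃ θ₀ ∈ Icc (0 : ℝ) π, f θ₀ = f (θ₀ + π) := by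
  set F : ℝ → ℝ := fun θ => f θ - f (θ + π) with hF
  have hFc : Continuous F := hf.sub (hf.comp (continuous_id.add continuous_const))
  have hFπ : F π = -F 0 := by
    simp only [hF, zero_add]
    rw [show π + π = 2 * π by ring, h2π]
    ring
  have key : ∃ θ₀ ∈ Icc (0 : ℝ) π, F θ₀ = 0 := by
    rcases le_or_gt (F 0) 0 with h0 | h0
    · have hmem : (0 : ℝ) ∈ Icc (F 0) (F π) := ⟨h0, by rw [hFπ]; linarith⟩
      exact intermediate_value_Icc Real.pi_pos.le hFc.continuousOn hmem
    · have hmem : (0 : ℝ) ∈ Icc (F π) (F 0) := ⟨by rw [hFπ]; linarith, h0.le⟩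
      exact intermediate_value_Icc' Real.pi_pos.le hFc.continuousOn hmem
  obtain ⟨θ₀, hθ₀, hF0⟩ := key
  exact ⟨θ₀, hθ₀, sub_eq_zero.1 hF0⟩

/-- Antipodal points of a circle of non-zero radius are distinct. [folklore] -/
theorem circleMap_ne_circleMap_add_pi {z : ℂ} {r : ℝ} (hr : r ≠ 0) (θ : ℝ) :
    circleMap z r θ ≠ circleMap z r (θ + π) := by
  intro h
  simp only [circleMap, add_right_inj] at h
  rw [Complex.ofReal_add, add_mul, Complex.exp_add, Complex.exp_pi_mul_I] at h
  have hexp : Complex.exp (θ * Complex.I) ≠ 0 := Complex.exp_ne_zero _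
  have hr' : (r : ℂ) ≠ 0 := Complex.ofReal_ne_zero.2 hr
  have : (r : ℂ) * Complex.exp (θ * Complex.I) * 2 = 0 := by linear_combination h
  simp [hr', hexp] at this

/-- **A simple curve covers no open set** (a Jordan arc in the plane has empty interior). If
`γ : [0, 1] → ℂ` is continuous and injective and `U` is a non-empty open set, then `U ⊄ trace γ`:
otherwise a circle `C ⊆ U` is contained in the trace, `γ` is a homeomorphism onto its trace
(compact to Hausdorff), and `γ⁻¹ ∘ C` would be a continuous injection of a circle into `[0, 1]`,
contradicting `exists_eq_add_pi_of_continuous`. [folklore] -/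
theorem not_subset_range_of_injective_curve {γ : Curve ℂ} (hγ : Function.Injective γ)
    {U : Set ℂ} (hU : IsOpen U) (hne : U.Nonempty) : ¬ U ⊆ γ.range := by
  intro hsub
  obtain ⟨z, hz⟩ := hne
  obtain ⟨ε, hε, hball⟩ := Metric.isOpen_iff.1 hU z hz
  set r : ℝ := ε / 2 with hr
  have hr0 : r ≠ 0 := by positivity
  -- the circle of radius `ε/2` about `z` lies in the trace
  have hmem : ∀ θ : ℝ, circleMap z r θ ∈ Set.range γ := fun θ => hsub (hball (by
    rw [mem_ball, mem_sphere.1 (circleMap_mem_sphere z (by positivity : (0 : ℝ) ≤ r) θ), hr]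
    linarith))
  -- `γ` is a homeomorphism onto its trace
  have hemb : IsClosedEmbedding γ := γ.continuous.isClosedEmbedding hγ
  set h : unitInterval ≃ₜ Set.range γ := hemb.isEmbedding.toHomeomorph with hh
  -- the continuous parameter of the circle point
  set t : ℝ → unitInterval := fun θ => h.symm ⟨circleMap z r θ, hmem θ⟩ with ht
  have htc : Continuous t :=
    h.symm.continuous.comp ((continuous_circleMap z r).subtype_mk fun θ => hmem θ)
  have hγt : ∀ θ : ℝ, (h (t θ) : ℂ) = circleMap z r θ := fun θ => by
    simp only [ht, Homeomorph.apply_symm_apply]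
  have hper : t (2 * π) = t 0 := by
    simp only [ht]
    congr 1
    apply Subtype.ext
    show circleMap z r (2 * π) = circleMap z r 0
    have hp := periodic_circleMap z r 0
    rwa [zero_add] at hp
  -- a continuous real function on the circle takes equal values at antipodal points
  obtain ⟨θ₀, -, hθ₀⟩ := exists_eq_add_pi_of_continuous (continuous_subtype_val.comp htc)
    (by simp only [Function.comp_apply, hper])
  have heq : t θ₀ = t (θ₀ + π) := Subtype.ext hθ₀
  have := congrArg (fun s => (h s : ℂ)) heq
  simp only [hγt] at this
  exact circleMap_ne_circleMap_add_pi hr0 θ₀ this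

/-- Curve-class form: a simple curve class (`CurveClass.simple`) is onto no non-empty open set.
[folklore] -/
theorem not_subset_range_of_mem_simple {c : CurveClass ℂ} (hc : c ∈ CurveClass.simple)
    {U : Set ℂ} (hU : IsOpen U) (hne : U.Nonempty) : ¬ U ⊆ c.range := by
  obtain ⟨γ, hγ, rfl⟩ := hc
  rw [CurveClass.range_mk]
  exact not_subset_range_of_injective_curve hγ hU hne

end Arc

/-! ### Chordal SLE_κ, `0 < κ ≤ 4`, is not almost surely onto the domain — unconditionally -/

section SLE

variable {κ : ℝ≥0} {D : DobrushinDomain} {Γ : (ℝ≥0 → ℝ) → CurveClass ℂ}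

/-- **Chordal SLE_κ in `(D; a, b)`, `0 < κ ≤ 4`, is almost surely NOT onto `D`** — indeed almost
surely a simple curve (Rohde–Schramm 2005, Thm. 6.1, PROVED in the tree:
`ae_isSimpleTrace_sleTrace_of_le_four_holds`, transported to the domain by `IsSLELaw.ae_simple`
with `CurveClass.measurableSet_simple_holds`), and a simple curve covers no open set
(`not_subset_range_of_injective_curve`). No named fact is used. [cite: RohdeSchramm2005, Thm 6.1] -/
theorem ae_not_carrier_subset_range_of_isSLECurve (h0 : 0 < κ) (h4 : κ ≤ 4)
    (hΓ : IsSLECurve κ D Γ) :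
    ∀ᵐ ω ∂Literature.Probability.Process.preWienerMeasure, ¬ D.carrier ⊆ (Γ ω).range := by
  have hs := IsSLELaw.ae_simple ae_isSimpleTrace_sleTrace_of_le_four_holds
    CurveClass.measurableSet_simple_holds h0 h4 hΓ.isSLELaw_map
  have hs' : ∀ᵐ ω ∂Literature.Probability.Process.preWienerMeasure, Γ ω ∈ CurveClass.simple :=
    ae_of_ae_map hΓ.aemeasurable (hs.mono fun _ h => h.1)
  filter_upwards [hs'] with ω hω
  exact not_subset_range_of_mem_simple hω D.isOpen D.nonempty

/-- Hence chordal SLE_κ, `0 < κ ≤ 4`, is not almost surely onto `D` (the pre-Wiener measure is a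
probability measure, `isProjectiveLimit_preWienerMeasure_holds`): the hypothesis `hκ` of
`IsSpaceFillingLaws.not_convergesInLawToSLE_of_not_ae_onto` (`…ProofsNarrow`), discharged.
[cite: RohdeSchramm2005, Thm 6.1] -/
theorem not_ae_carrier_subset_range_of_isSLECurve (h0 : 0 < κ) (h4 : κ ≤ 4)
    (hΓ : IsSLECurve κ D Γ) :
    ¬ ∀ᵐ ω ∂Literature.Probability.Process.preWienerMeasure, D.carrier ⊆ (Γ ω).range := by
  haveI := Literature.Probability.Process.isProbabilityMeasure_preWienerMeasure
    isProjectiveLimit_preWienerMeasure_holds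
  intro hon
  obtain ⟨ω, hω₁, hω₂⟩ := ((ae_not_carrier_subset_range_of_isSLECurve h0 h4 hΓ).and hon).exists
  exact hω₁ hω₂

end SLE

/-! ### The barrier's technique class refuted with no named fact -/

section Unconditional

variable {κ : ℝ≥0} {D : DobrushinDomain} {A B : ℝ → Site 2}
  {P : ∀ δ : ℝ, Measure (DomainSAW D.carrier δ (A δ) (B δ))}

/-- **Weakly space-filling SAW laws converge to no chordal SLE_κ with `0 < κ ≤ 4`**
(unconditional form of the barrier mechanism: `…ProofsNarrow` with its SLE input discharged by
`not_ae_carrier_subset_range_of_isSLECurve`). [cite: DuminilCopinKozmaYadin2014, §1 (When x > 1/μ)] -/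
theorem IsSpaceFillingLaws.not_convergesInLawToSLE_of_le_four [∀ δ, IsFiniteMeasure (P δ)]
    (hfill : IsSpaceFillingLaws D.carrier A B P) (h0 : 0 < κ) (h4 : κ ≤ 4) :
    ¬ ConvergesInLawToSLE κ D (fun δ (γ : DomainSAW D.carrier δ (A δ) (B δ)) => γ.curve) P :=
  hfill.not_convergesInLawToSLE_of_not_ae_onto fun _ hΓ =>
    not_ae_carrier_subset_range_of_isSLECurve h0 h4 hΓ

/-- **For every supercritical fugacity `x > x_c` and every `0 < κ ≤ 4`, the SAW with parameter
`x` in `(𝔻; 1, -1)` with closest-site endpoints does not converge in law to chordal SLE_κ** —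
a theorem of the tree with no hypothesis: Theorem 1 of the source (`DKY2014_thm1_holds`) and
Rohde–Schramm's simplicity theorem (`ae_isSimpleTrace_sleTrace_of_le_four_holds`).
[cite: DuminilCopinKozmaYadin2014, Theorem 1] -/
theorem not_convergesInLawToSLE_supercritical_unitDisc {x : ℝ} (hx : criticalFugacity < x)
    (h0 : 0 < κ) (h4 : κ ≤ 4)
    (hAB : ∀ δ : ℝ, 0 < δ → IsClosestSite unitDisk δ 1 (A δ) ∧ IsClosestSite unitDisk δ (-1) (B δ)) :
    ¬ ConvergesInLawToSLE κ DobrushinDomain.unitDisc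
        (fun δ (γ : DomainSAW DobrushinDomain.unitDisc.carrier δ (A δ) (B δ)) => γ.curve)
        (fun δ => lawAt x DobrushinDomain.unitDisc.carrier δ (A δ) (B δ)) := by
  have hne : (1 : ℂ) ≠ -1 := fun h => by
    have h' := congrArg Complex.re h
    norm_num at h'
  -- `DobrushinDomain.unitDisc.carrier = unitDisk` definitionally (`carrier_unitDisc`)
  have hfill : IsSpaceFillingLaws DobrushinDomain.unitDisc.carrier A B
      (fun δ => lawAt x DobrushinDomain.unitDisc.carrier δ (A δ) (B δ)) :=
    isSpaceFillingLaws_lawAt_iff.2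
      (isSpaceFillingFamily_of_DKY2014_thm1 DKY2014_thm1_holds (by simp) (by simp) hne hAB hx)
  exact hfill.not_convergesInLawToSLE_of_le_four h0 h4

/-- **`¬ SAWScalingLimitAt x` for every `x > x_c`, unconditionally** (the statement
`not_sawScalingLimitAt_of_DKY2014_thm1` of `…Refutation` with all three of its hypotheses —
Theorem 1, [LSW03] Thm 6.1, [RS05] Thm 6.1 — removed: the first and third are proved in the
tree, the second is not needed). [cite: DuminilCopinKozmaYadin2014, Theorem 1] -/
theorem not_sawScalingLimitAt_of_lt {x : ℝ} (hx : criticalFugacity < x) : ¬ SAWScalingLimitAt x := by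
  obtain ⟨A, hA⟩ := exists_closestSiteFamily (1 : ℂ)
  obtain ⟨B, hB⟩ := exists_closestSiteFamily (-1 : ℂ)
  have hAB : ∀ δ : ℝ, 0 < δ →
      IsClosestSite unitDisk δ 1 (A δ) ∧ IsClosestSite unitDisk δ (-1) (B δ) :=
    fun δ hδ => ⟨hA δ hδ, hB δ hδ⟩
  intro h
  exact not_convergesInLawToSLE_supercritical_unitDisc hx (by positivity)
    (by rw [div_le_iff₀ (by norm_num : (0 : ℝ≥0) < 3)]; norm_num) hAB
    (h DobrushinDomain.unitDisc A B (isEndpointApprox_unitDisc_of_isClosestSite hAB))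

/-- **The technique class of the barrier is false, unconditionally**: `¬ RobustSAWScalingLimit`
as a hypothesis-free theorem of the tree (compare `SupercriticalSAWSpaceFilling.not_robustSAWScalingLimit`
of `…Refutation`, conditional on the restriction formula [LSW03, Thm 6.1] and on [RS05, Thm 6.1]).
[cite: DuminilCopinKozmaYadin2014, Theorem 1] -/
theorem not_robustSAWScalingLimit : ¬ RobustSAWScalingLimit := fun h => by
  obtain ⟨x, hx, hlim⟩ := h.supercritical
  exact not_sawScalingLimitAt_of_lt hx hlim

/-- **Problem 10 in `(𝔻; 1, -1)` follows from the Lawler–Schramm–Werner conjecture alone**: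
if `SAWScalingLimit` holds, no closest-site critical family in the unit disc is weakly
space-filling (`DKY2014_problem10_unitDisc_of_sawScalingLimit_of_facts` of `…Refutation` with
its two SLE hypotheses removed). [cite: DuminilCopinKozmaYadin2014, Problem 10] -/
theorem DKY2014_problem10_unitDisc_of_sawScalingLimit' (hSAW : SAWScalingLimit)
    (h : ∀ δ : ℝ, 0 < δ → IsClosestSite unitDisk δ 1 (A δ) ∧ IsClosestSite unitDisk δ (-1) (B δ)) :
    ¬ IsSpaceFillingFamily criticalFugacity unitDisk A B := fun hfill => by
  have hfill' : IsSpaceFillingLaws DobrushinDomain.unitDisc.carrier A B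
      (fun δ => lawAt criticalFugacity DobrushinDomain.unitDisc.carrier δ (A δ) (B δ)) :=
    isSpaceFillingLaws_lawAt_iff.2 hfill
  exact hfill'.not_convergesInLawToSLE_of_le_four (by positivity)
    (by rw [div_le_iff₀ (by norm_num : (0 : ℝ≥0) < 3)]; norm_num)
    (hSAW DobrushinDomain.unitDisc A B (isEndpointApprox_unitDisc_of_isClosestSite h))

end Unconditional

end SupercriticalSAW

end Literature.Barriers.CriticalPhenomena
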